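import Literature.Barriers.QuantumAdvantage.UncorrectedNoiseFourier
import Literature.Computability.QuantumComplexity.NonunitalReadoutAnticoncentration
import HarnessLib

/-!
# Biased-readout truncation: the Bremner–Montanaro–Shepherd low-degree estimate for an arbitrary
# memoryless binary read-out channel

Literature record — LAW-LEVEL finite identities and one ℓ₁-truncation inequality for a pushed-forward
distribution, plus the dictionary to the catalogued engine. No complexity class, sampler, evaluator or
algorithm is defined or described here; nothing in this file proves or refutes a quantum-advantage
conjecture.

**The catalogued barrier and its typed class.** `Literature.Barriers.QuantumAdvantage.UncorrectedNoise`
(Bremner–Montanaro–Shepherd 2017, Thm 4) is typed for END-OF-CIRCUIT SYMMETRIC bit flips — the noise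
operator `noiseOp η` of `UncorrectedNoiseFourier`, whose Fourier core is `truncation_l1_sq_le`:
`‖q̃ − 𝒩_η p‖₁² ≤ 2^{2N} Σ_{|S|≤ℓ} (c_S − (1−2η)^{|S|} p̂(S))² + ((1−2η)²)^{ℓ+1}·2^N Σ_x p(x)²`
("it is not clear that more general noise models …", ibid. §1, p. 8).

**Just outside that class.** A general memoryless binary read-out channel with single-bit kernel
`k a b = Pr[read a | bit b]` (`NonunitalReadout.kPush k` of `NonunitalReadoutAnticoncentration`;
amplitude-damped read-out is the Z-channel `zKer q`, symmetric flips are `fKer η`) is in general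
ASYMMETRIC and NON-UNITAL: it does not commute with bit flips, it maps the uniform input to the biased
product law `bern (bias k)`, and its output need not be anticoncentrated
(`NonunitalReadout.DampedReadoutNoAnticoncentration`). The records below show that the truncation
INEQUALITY survives with the same shape once the output side is expanded in the `bias k`-BIASED product
basis `ψ_S` (O'Donnell 2014, Def. 8.39–8.40) instead of the Walsh basis:

* R1 `BiasedExpansion` — the exact read-out law `kPush k p` in the biased basis, every ideal Walsh
  coefficient `p̂(S)` damped by `(c/v)^{|S|}` (`m = bias k`, `c = gain k`, `v = bvar k = m(1−m) ≠ 0`);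
* R2 `BiasedOrthogonality` — `Σ_y bern m y ψ_S ψ_T = [S = T] v^{|S|}`;
* R3 `ReadoutTruncationBound` (headline) — for column-stochastic `k ≥ 0` with `0 < bias k < 1`, real
  `p`, any `ℓ` and any table `d` vanishing above degree `ℓ`:
  `(Σ_y |biasedFn k d y − kPush k p y|)² ≤ 2^{2N} Σ_{|S|≤ℓ} ρ₂^{|S|}(d_S − p̂(S))² + ρ₂^{ℓ+1}·2^N Σ_x p(x)²`,
  `ρ₂ = rho2 k = c²/v ∈ [0,1]`; so GIVEN input anticoncentration `Σ_x p(x)² ≤ α2^{-N}` and a table `d` of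
  low-degree coefficients as in BMS17 §3 (there supplied by an evaluator; none is constructed here) the
  tail is `ρ₂^{ℓ+1} α` uniformly in `N`; at the one-sided `zKer q`, `ρ₂ = (1−q)/(1+q)` (`zChannel_instance`);
* R4 `SymmetricInstance` — at `k = fKer η`: `bias = 1/2`, `ρ₂ = (1−2η)²`, `kPush (fKer η) = noiseOp η`,
  `biasedFn (fKer η) d = fourierFn (S ↦ (1−2η)^{|S|} d_S)`, and R3 IS the tree's `truncation_l1_sq_le` at
  `c_S = (1−2η)^{|S|} d_S` (same `2^{2N}`, same tail; `symmetricInstance_of_tree` re-proves the record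
  from the tree lemma) — the record extends the catalogued engine, it builds no parallel model;
* R5 `UniformBasisTail` — off the symmetric point the Walsh-basis certificate is the wrong tool: the
  read-out `bern m` of the trivial input has Walsh tail EXACTLY `Σ_{ℓ<j≤N} C(N,j)((1−2m)²)^j`
  (`≥ C(N,ℓ+1)((1−2m)²)^{ℓ+1}`, unbounded in `N` at fixed `ℓ`), where the biased error of R3 is `0`;
* R6 `PerfectFlag` — the bare identity `kPush (zKer q) p 1^N = (1−q)^N p(1^N)` (the flag identity that
  post-selection arguments use, cf. `IQPPostselection`; nothing about classes is typed here).

Degenerate kernels: CONSTANT channels (`bias ∈ {0,1}`, point-mass output) are excluded by the binders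
of R3; the identity / NOT channels `fKer 0`, `fKer 1` have `ρ₂ = 1` (`rho2_fKer_det`) and R3 holds with
a non-decaying tail, as it must. `numbers` (illustration): `rho2 (zKer (1/10)) = 9/11`; least `ℓ+1`
with `ρ₂^{ℓ+1}·800 ≤ 1`: `34` (`zKer 1/10`), `32` (`fKer 1/20`), `11` (`zKer 3/10`); Walsh-tail witness
`C(20,3)/4^3 = 1140/64 > 17`. Honest residue: only the Fourier core is generalised; the machine-level
statements `UncorrectedNoiseMachine*` are not re-typed for biased read-out.
-/

noncomputable section

namespace Literature.Computability.QuantumComplexity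
namespace BiasedReadout

open Finset
open Literature.Probability.RandomGraphs.LowDegree (sgn walsh sgn_true sgn_false)
open Literature.Computability.Complexity.LowDegree (cubeFourierCoeff sum_cubeFourierCoeff_sq)
open Literature.Barriers.QuantumAdvantage (noiseOp fourierFn flipWeight bxor)
open NonunitalReadout (kPush zKer fKer flipWt xorV kPush_fKer)

variable {N : ℕ}

/-! ### §1 The single-bit kernel: bias, gain, variance, damping ratio -/

/-- The output bias on a uniformly random bit: `m(k) = (k(1|0) + k(1|1))/2 = Pr[read 1]`. [cite: ODonnell2014, Def. 8.39 (the mean μ of a biased bit)] -/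
def bias (k : Bool → Bool → ℝ) : ℝ := (k true false + k true true) / 2

/-- The gain `c(k) = (k(1|1) − k(1|0))/2` (`(1−2η)/2` for the symmetric flip, `(1−q)/2` for the Z-channel).
[cite: BremnerMontanaroShepherd2017, §3 (the damping factor 1−ε of the noise operator, here per kernel)] -/
def gain (k : Bool → Bool → ℝ) : ℝ := (k true true - k true false) / 2

/-- The output variance `v(k) = m(1−m)`. [cite: ODonnell2014, Def. 8.39 (σ² = 1 − μ² in ±1 conventions; here {0,1})] -/
def bvar (k : Bool → Bool → ℝ) : ℝ := bias k * (1 - bias k)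

/-- The squared damping ratio `ρ₂(k) = c²/v` (squared input/read-out correlation under a uniform input;
`(1−2η)²` for `fKer η`, `(1−q)/(1+q)` for `zKer q`). [cite: BremnerMontanaroShepherd2017, §3.1 (the factor (1−ε)^{2(ℓ+1)} of display 2)] -/
def rho2 (k : Bool → Bool → ℝ) : ℝ := gain k ^ 2 / bvar k

/-- The single biased bit law `bern1 m b = m^{[b]} (1−m)^{[¬b]}`. [cite: ODonnell2014, §8.4 (the p-biased bit π_p)] -/
def bern1 (m : ℝ) (b : Bool) : ℝ := if b then m else 1 - m

/-- The biased product law `bern m y = Π_i bern1 m (y i)` on `{0,1}^N`. [cite: ODonnell2014, §8.4 (π_p^{⊗n})] -/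
def bern (m : ℝ) (y : Fin N → Bool) : ℝ := ∏ i, bern1 m (y i)

/-- The centred bit `ψ_m(b) = m − [b]` (`E ψ = 0`, `E ψ² = m(1−m)` under `bern1 m`). [cite: ODonnell2014, Def. 8.39 (φ = (x − μ)/σ, un-normalised)] -/
def psi (m : ℝ) (b : Bool) : ℝ := if b then m - 1 else m

/-- The biased product character `ψ_S(y) = Π_{i ∈ S} ψ_m(y i)`. [cite: ODonnell2014, Def. 8.40 (φ_S = Π_{i∈S} φ(x_i))] -/
def psiProd (m : ℝ) (S : Finset (Fin N)) (y : Fin N → Bool) : ℝ := ∏ i ∈ S, psi m (y i)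

/-- **The single-bit decomposition.** For a column-stochastic kernel, `v·k(a|b) = bern1 m a · (v + c·sgn b·ψ_m(a))`:
the biased bit law tilted by the centred bit, signed by the input. [cite: ODonnell2014, Exercise 8.25 and Def. 8.39 (usual versus biased expansion of one bit)] -/
theorem kernel_decomp (k : Bool → Bool → ℝ) (hcol : ∀ b, k false b + k true b = 1) (a b : Bool) :
    bvar k * k a b = bern1 (bias k) a * (bvar k + gain k * sgn b * psi (bias k) a) := by
  have h0 := hcol false
  have h1 := hcol true
  cases a <;> cases b <;>
    simp only [bvar, bias, gain, bern1, psi, sgn_true, sgn_false, Bool.false_eq_true, if_false,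
      if_true]
  · linear_combination ((k true false + k true true) / 2 * (1 - (k true false + k true true) / 2)) * h0
  · linear_combination ((k true false + k true true) / 2 * (1 - (k true false + k true true) / 2)) * h1
  · ring
  · ring

/-- `ρ₂ ≥ 0` when `0 < m < 1`. [cite: BremnerMontanaroShepherd2017, §3.1 (0 ≤ (1−ε)² ≤ 1)] -/
theorem rho2_nonneg (k : Bool → Bool → ℝ) (hm0 : 0 < bias k) (hm1 : bias k < 1) : 0 ≤ rho2 k :=
  div_nonneg (sq_nonneg _) (mul_nonneg hm0.le (by linarith))

/-- `ρ₂ ≤ 1` for a column-stochastic nonnegative kernel (`m(1−m) − c² = (k(1|0)(1−k(1|0)) + k(1|1)(1−k(1|1)))/2 ≥ 0`). [cite: BremnerMontanaroShepherd2017, §3.1 (0 ≤ (1−ε)² ≤ 1)] -/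
theorem rho2_le_one (k : Bool → Bool → ℝ) (hcol : ∀ b, k false b + k true b = 1)
    (h0 : ∀ a b, 0 ≤ k a b) (hm0 : 0 < bias k) (hm1 : bias k < 1) : rho2 k ≤ 1 := by
  have hv : 0 < bvar k := mul_pos hm0 (by linarith)
  rw [rho2, div_le_one hv]
  have hu0 := h0 true false
  have hw0 := h0 true true
  have hu1 : k true false ≤ 1 := by linarith [hcol false, h0 false false]
  have hw1 : k true true ≤ 1 := by linarith [hcol true, h0 false true]
  simp only [gain, bvar, bias]
  nlinarith [mul_nonneg hu0 (sub_nonneg.2 hu1), mul_nonneg hw0 (sub_nonneg.2 hw1)]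

/-- `ρ₂ < 1` unless the kernel is deterministic: for `0 < m < 1`, `ρ₂ < 1 ↔ k(1|0)(1−k(1|0)) + k(1|1)(1−k(1|1)) > 0`.
[cite: BremnerMontanaroShepherd2017, Thm 4 (any constant noise rate ε > 0 suffices)] -/
theorem rho2_lt_one_iff (k : Bool → Bool → ℝ) (hm0 : 0 < bias k) (hm1 : bias k < 1) :
    rho2 k < 1 ↔ 0 < k true false * (1 - k true false) + k true true * (1 - k true true) := by
  have hv : 0 < bvar k := mul_pos hm0 (by linarith)
  rw [rho2, div_lt_one hv]
  simp only [gain, bvar, bias]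
  constructor <;> intro h <;> nlinarith [h]

/-! ### §2 The biased product law and its characters -/

/-- `Σ_b bern1 m b = 1`. [cite: ODonnell2014, §8.4 (π_p is a probability distribution)] -/
theorem sum_bern1 (m : ℝ) : ∑ b, bern1 m b = 1 := by
  rw [Fintype.sum_bool]; simp [bern1]

/-- `Σ_y bern m y = 1`. [cite: ODonnell2014, §8.4 (π_p^{⊗n} is a probability distribution)] -/
theorem sum_bern (m : ℝ) : ∑ y : Fin N → Bool, bern m y = 1 := by
  simp only [bern]
  rw [← Fintype.prod_sum (fun (_ : Fin N) (b : Bool) => bern1 m b)]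
  simp_rw [sum_bern1]
  exact prod_const_one

/-- `bern m ≥ 0` for `m ∈ [0,1]`. [cite: ODonnell2014, §8.4 (π_p^{⊗n})] -/
theorem bern_nonneg {m : ℝ} (hm0 : 0 ≤ m) (hm1 : m ≤ 1) (y : Fin N → Bool) : 0 ≤ bern m y :=
  prod_nonneg fun i _ => by unfold bern1; split_ifs <;> linarith

/-- A biased character as a product over all coordinates. [cite: ODonnell2014, Def. 8.40] -/
theorem psiProd_eq_prod_ite (m : ℝ) (S : Finset (Fin N)) (y : Fin N → Bool) :
    psiProd m S y = ∏ i, (if i ∈ S then psi m (y i) else 1) := by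
  rw [psiProd, Fintype.prod_ite_mem]

/-- The one-bit moments `E ψ = 0`, `E ψ² = m(1−m)`, in the form used for orthogonality. [cite: ODonnell2014, Def. 8.39 (E φ = 0, E φ² = 1)] -/
theorem sum_bern1_mul_ite (m : ℝ) (P Q : Prop) [Decidable P] [Decidable Q] :
    ∑ b, bern1 m b * ((if P then psi m b else 1) * (if Q then psi m b else 1)) =
      if P then (if Q then m * (1 - m) else 0) else (if Q then 0 else 1) := by
  rw [Fintype.sum_bool]
  by_cases hP : P <;> by_cases hQ : Q <;> simp [hP, hQ, bern1, psi] <;> ring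

/-- **R2 · biased orthogonality**: `Σ_y bern m y ψ_S(y) ψ_T(y) = [S = T] (m(1−m))^{|S|}` for every real
`m`. [cite: ODonnell2014, Def. 8.40 and Prop. 8.10 (orthonormality of the product Fourier basis φ_S)] -/
theorem sum_bern_psiProd_mul_psiProd (m : ℝ) (S T : Finset (Fin N)) :
    ∑ y : Fin N → Bool, bern m y * (psiProd m S y * psiProd m T y) =
      if S = T then (m * (1 - m)) ^ S.card else 0 := by
  classical
  have key : ∀ y : Fin N → Bool, bern m y * (psiProd m S y * psiProd m T y) =
      ∏ i, (bern1 m (y i) * ((if i ∈ S then psi m (y i) else 1) * (if i ∈ T then psi m (y i) else 1))) := by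
    intro y
    rw [bern, psiProd_eq_prod_ite, psiProd_eq_prod_ite, ← prod_mul_distrib, ← prod_mul_distrib]
  simp_rw [key]
  rw [← Fintype.prod_sum (fun (i : Fin N) (b : Bool) =>
    bern1 m b * ((if i ∈ S then psi m b else 1) * (if i ∈ T then psi m b else 1)))]
  simp_rw [sum_bern1_mul_ite]
  by_cases hST : S = T
  · subst hST
    rw [if_pos rfl]
    have : ∀ i : Fin N, (if i ∈ S then (if i ∈ S then m * (1 - m) else 0) else (if i ∈ S then 0 else 1))
        = if i ∈ S then m * (1 - m) else 1 := by
      intro i; by_cases hi : i ∈ S <;> simp [hi]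
    simp_rw [this]
    rw [Fintype.prod_ite_mem, prod_const]
  · rw [if_neg hST]
    obtain ⟨i, hi⟩ : ∃ i, ¬ (i ∈ S ↔ i ∈ T) := by
      by_contra h
      push Not at h
      exact hST (Finset.ext h)
    apply prod_eq_zero (mem_univ i)
    by_cases hiS : i ∈ S
    · have hiT : i ∉ T := fun hiT => hi ⟨fun _ => hiT, fun _ => hiS⟩
      simp [hiS, hiT]
    · have hiT : i ∈ T := by
        by_contra hiT; exact hi ⟨fun h => absurd h hiS, fun h => absurd h hiT⟩
      simp [hiS, hiT]

/-- **Weighted Parseval in the biased basis**: `Σ_y bern m y (Σ_S e_S ψ_S(y))² = Σ_S e_S² (m(1−m))^{|S|}`. [cite: ODonnell2014, §8.1 (Parseval for an orthogonal product basis, (8.2))] -/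
theorem sum_bern_mul_sq_synthesis (m : ℝ) (e : Finset (Fin N) → ℝ) :
    ∑ y : Fin N → Bool, bern m y * (∑ S, e S * psiProd m S y) ^ 2 =
      ∑ S, e S ^ 2 * (m * (1 - m)) ^ S.card := by
  calc ∑ y : Fin N → Bool, bern m y * (∑ S, e S * psiProd m S y) ^ 2
      = ∑ y : Fin N → Bool, ∑ S, ∑ T, e S * e T * (bern m y * (psiProd m S y * psiProd m T y)) := by
        refine sum_congr rfl fun y _ => ?_
        rw [sq, sum_mul_sum, mul_sum]
        refine sum_congr rfl fun S _ => ?_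
        rw [mul_sum]
        refine sum_congr rfl fun T _ => ?_
        ring
    _ = ∑ S, ∑ T, e S * e T * ∑ y : Fin N → Bool, bern m y * (psiProd m S y * psiProd m T y) := by
        rw [sum_comm]
        refine sum_congr rfl fun S _ => ?_
        rw [sum_comm]
        refine sum_congr rfl fun T _ => ?_
        rw [mul_sum]
    _ = ∑ S, e S ^ 2 * (m * (1 - m)) ^ S.card := by
        refine sum_congr rfl fun S _ => ?_
        simp_rw [sum_bern_psiProd_mul_psiProd, mul_ite, mul_zero]
        rw [sum_ite_eq univ S]
        simp [sq]

/-- **Weighted Cauchy–Schwarz / Jensen**: `(Σ_y |bern m y · G y|)² ≤ Σ_y bern m y · G(y)²` (`m ∈ [0,1]`). [cite: BremnerMontanaroShepherd2017, §3.1 (first display: ℓ₁ by ℓ₂), against the biased law] -/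
theorem l1_sq_le_weighted_l2_sq {m : ℝ} (hm0 : 0 ≤ m) (hm1 : m ≤ 1) (G : (Fin N → Bool) → ℝ) :
    (∑ y, |bern m y * G y|) ^ 2 ≤ ∑ y, bern m y * G y ^ 2 := by
  have h := NonunitalReadout.sq_wsum_le (bern m) (fun y => |G y|) (bern_nonneg hm0 hm1) (sum_bern m)
  have habs : ∀ y : Fin N → Bool, |bern m y * G y| = bern m y * |G y| := fun y => by
    rw [abs_mul, abs_of_nonneg (bern_nonneg hm0 hm1 y)]
  simp_rw [habs]
  simpa only [sq_abs] using h

/-! ### §3 R1 — the exact read-out formula in the biased basis -/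

/-- The product kernel, factored through the single-bit decomposition (`v ≠ 0`). [cite: ODonnell2014, Exercise 8.25 (usual-to-biased change of basis), coordinate-wise] -/
theorem prod_kernel_eq (k : Bool → Bool → ℝ) (hcol : ∀ b, k false b + k true b = 1) (hv : bvar k ≠ 0)
    (y x : Fin N → Bool) :
    ∏ i, k (y i) (x i) =
      bern (bias k) y * ∏ i, (1 + gain k / bvar k * sgn (x i) * psi (bias k) (y i)) := by
  rw [bern, ← prod_mul_distrib]
  refine prod_congr rfl fun i _ => ?_
  have h := kernel_decomp k hcol (y i) (x i)
  have hk : k (y i) (x i) = (bvar k)⁻¹ * (bvar k * k (y i) (x i)) := by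
    rw [← mul_assoc, inv_mul_cancel₀ hv, one_mul]
  rw [hk, h]
  field_simp

/-- The tilt product over subsets: `Π_i (1 + t·sgn(x_i)ψ(y_i)) = Σ_S t^{|S|} χ_S(x) ψ_S(y)`. [cite: ODonnell2014, §8.1 (expansion in a product basis), elementary] -/
theorem prod_one_add_tilt (t m : ℝ) (y x : Fin N → Bool) :
    ∏ i, (1 + t * sgn (x i) * psi m (y i)) =
      ∑ S : Finset (Fin N), t ^ S.card * walsh S x * psiProd m S y := by
  rw [prod_one_add, powerset_univ]
  refine sum_congr rfl fun S _ => ?_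
  rw [prod_mul_distrib, prod_mul_distrib, prod_const, walsh, psiProd]

/-- The biased synthesis of an IDEAL-side coefficient table `d` (in BMS17 §3.1: `d_S ≈ p̂(S)` for `|S| ≤ ℓ`, `0`
above): `F_d(y) = bern m y · Σ_S (c/v)^{|S|} (2^N d_S) ψ_S(y)`. [cite: BremnerMontanaroShepherd2017, §3.1 (the synthesised approximation q̃ = Σ_{|S|≤ℓ} c_S χ_S), biased form] -/
def biasedFn (k : Bool → Bool → ℝ) (d : Finset (Fin N) → ℝ) (y : Fin N → Bool) : ℝ :=
  bern (bias k) y * ∑ S, (gain k / bvar k) ^ S.card * (2 ^ N * d S) * psiProd (bias k) S y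

/-- **R1 · the read-out law in the biased basis (exact)**: for a column-stochastic kernel with `v ≠ 0`,
`kPush k p y = bern m y · Σ_S (c/v)^{|S|} (2^N p̂(S)) ψ_S(y)` — each ideal Walsh coefficient damped by `(c/v)^{|S|}`
and re-synthesised against the OUTPUT-biased character (at `k = fKer η`: BMS17's `𝒩_ε p = Σ_S (1−ε)^{|S|} p̂(S) χ_S`).
[cite: BremnerMontanaroShepherd2017, §3 (the noise operator damps degree-|S| coefficients by (1−ε)^{|S|}); ODonnell2014, Def. 8.40] -/
theorem kPush_eq_biased (k : Bool → Bool → ℝ) (hcol : ∀ b, k false b + k true b = 1) (hv : bvar k ≠ 0)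
    (p : (Fin N → Bool) → ℝ) (y : Fin N → Bool) :
    kPush k p y = bern (bias k) y *
      ∑ S : Finset (Fin N), (gain k / bvar k) ^ S.card * (2 ^ N * cubeFourierCoeff p S) * psiProd (bias k) S y := by
  have h2 : ∀ S : Finset (Fin N), 2 ^ N * cubeFourierCoeff p S = ∑ x, p x * walsh S x := by
    intro S
    rw [cubeFourierCoeff, mul_div_cancel₀ _ (by positivity : (2 : ℝ) ^ N ≠ 0)]
  simp_rw [h2]
  unfold kPush
  simp_rw [prod_kernel_eq k hcol hv y, prod_one_add_tilt]
  calc ∑ x, bern (bias k) y * (∑ S : Finset (Fin N), (gain k / bvar k) ^ S.card * walsh S x * psiProd (bias k) S y) * p x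
      = bern (bias k) y * ∑ x, ∑ S : Finset (Fin N),
          (gain k / bvar k) ^ S.card * (p x * walsh S x) * psiProd (bias k) S y := by
        rw [mul_sum]
        refine sum_congr rfl fun x _ => ?_
        rw [mul_assoc, sum_mul, mul_sum, mul_sum]
        refine sum_congr rfl fun S _ => ?_
        ring
    _ = bern (bias k) y * ∑ S : Finset (Fin N),
          (gain k / bvar k) ^ S.card * (∑ x, p x * walsh S x) * psiProd (bias k) S y := by
        congr 1
        rw [sum_comm]
        refine sum_congr rfl fun S _ => ?_
        rw [mul_sum, sum_mul]

/-- R1 as a record. [cite: BremnerMontanaroShepherd2017, §3; ODonnell2014, Def. 8.40] -/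
def BiasedExpansion : Prop :=
  ∀ (N : ℕ) (k : Bool → Bool → ℝ), (∀ b, k false b + k true b = 1) → bvar k ≠ 0 →
    ∀ (p : (Fin N → Bool) → ℝ) (y : Fin N → Bool),
      kPush k p y = bern (bias k) y *
        ∑ S : Finset (Fin N), (gain k / bvar k) ^ S.card * (2 ^ N * cubeFourierCoeff p S) * psiProd (bias k) S y

/-- R1 holds. [cite: BremnerMontanaroShepherd2017, §3; ODonnell2014, Def. 8.40] -/
theorem biasedExpansion_holds : BiasedExpansion := fun _ k hcol hv p y => kPush_eq_biased k hcol hv p y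

/-- R2 as a record. [cite: ODonnell2014, Def. 8.40 and Prop. 8.10] -/
def BiasedOrthogonality : Prop :=
  ∀ (N : ℕ) (m : ℝ) (S T : Finset (Fin N)),
    ∑ y : Fin N → Bool, bern m y * (psiProd m S y * psiProd m T y) = if S = T then (m * (1 - m)) ^ S.card else 0

/-- R2 holds. [cite: ODonnell2014, Def. 8.40 and Prop. 8.10] -/
theorem biasedOrthogonality_holds : BiasedOrthogonality := fun _ m S T => sum_bern_psiProd_mul_psiProd m S T

/-! ### §4 R3 — the truncation estimate for an arbitrary binary read-out channel -/

/-- The error of a biased synthesis against the read-out law is the biased synthesis of the coefficient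
errors. [cite: BremnerMontanaroShepherd2017, §3.1 (q̃ − 𝒩p has coefficients c_S − (1−ε)^{|S|} p̂(S))] -/
theorem biasedFn_sub_kPush (k : Bool → Bool → ℝ) (hcol : ∀ b, k false b + k true b = 1) (hv : bvar k ≠ 0)
    (d : Finset (Fin N) → ℝ) (p : (Fin N → Bool) → ℝ) (y : Fin N → Bool) :
    biasedFn k d y - kPush k p y = bern (bias k) y *
      ∑ S : Finset (Fin N), ((gain k / bvar k) ^ S.card * (2 ^ N * (d S - cubeFourierCoeff p S))) * psiProd (bias k) S y := by
  rw [kPush_eq_biased k hcol hv, biasedFn, ← mul_sub, ← sum_sub_distrib]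
  congr 1
  refine sum_congr rfl fun S _ => ?_
  ring

/-- **R3 · HEADLINE — the read-out truncation bound.** For a column-stochastic nonnegative kernel `k` with
`0 < bias k < 1`, any real `p` on `{0,1}^N`, any `ℓ` and any coefficient table `d` vanishing above degree `ℓ`:
`(Σ_y |F_d(y) − (k-read-out of p)(y)|)² ≤ 2^{2N} Σ_{|S|≤ℓ} ρ₂^{|S|}(d_S − p̂(S))² + ρ₂^{ℓ+1}·2^N·Σ_x p(x)²` — the
Bremner–Montanaro–Shepherd estimate with `(1−ε)²` replaced by `ρ₂(k)`, uniformly in `N`.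
[cite: BremnerMontanaroShepherd2017, §3.1 (displays 1–2) and Thm 4; ODonnell2014, Def. 8.39–8.40] -/
theorem readout_truncation_l1_sq_le (k : Bool → Bool → ℝ) (hcol : ∀ b, k false b + k true b = 1)
    (h0 : ∀ a b, 0 ≤ k a b) (hm0 : 0 < bias k) (hm1 : bias k < 1)
    (p : (Fin N → Bool) → ℝ) (ℓ : ℕ) (d : Finset (Fin N) → ℝ) (hd : ∀ S, ℓ < S.card → d S = 0) :
    (∑ y, |biasedFn k d y - kPush k p y|) ^ 2 ≤
      2 ^ (2 * N) * ∑ S ∈ univ.filter (fun S : Finset (Fin N) => S.card ≤ ℓ),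
          rho2 k ^ S.card * (d S - cubeFourierCoeff p S) ^ 2 +
        rho2 k ^ (ℓ + 1) * 2 ^ N * ∑ x, p x ^ 2 := by
  have hv0 : 0 < bvar k := mul_pos hm0 (by linarith)
  have hv : bvar k ≠ 0 := hv0.ne'
  have hρ0 : 0 ≤ rho2 k := rho2_nonneg k hm0 hm1
  have hρ1 : rho2 k ≤ 1 := rho2_le_one k hcol h0 hm0 hm1
  set e : Finset (Fin N) → ℝ := fun S => (gain k / bvar k) ^ S.card * (2 ^ N * (d S - cubeFourierCoeff p S))
    with he
  -- Step 1: the error is `bern · G` with `G = Σ_S e_S ψ_S`; weighted Jensen.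
  have h1 : (∑ y, |biasedFn k d y - kPush k p y|) ^ 2 ≤
      ∑ y, bern (bias k) y * (∑ S, e S * psiProd (bias k) S y) ^ 2 := by
    have := l1_sq_le_weighted_l2_sq hm0.le hm1.le (fun y => ∑ S, e S * psiProd (bias k) S y) (N := N)
    refine le_of_eq_of_le ?_ this
    congr 1
    refine sum_congr rfl fun y _ => ?_
    rw [biasedFn_sub_kPush k hcol hv d p y]
  -- Step 2: weighted Parseval, and `e_S² v^{|S|} = 4^N ρ₂^{|S|} (d_S − p̂(S))²`.
  have h2 : ∑ y, bern (bias k) y * (∑ S, e S * psiProd (bias k) S y) ^ 2 =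
      2 ^ (2 * N) * ∑ S : Finset (Fin N), rho2 k ^ S.card * (d S - cubeFourierCoeff p S) ^ 2 := by
    rw [sum_bern_mul_sq_synthesis, mul_sum]
    refine sum_congr rfl fun S _ => ?_
    have hρ : rho2 k = (gain k / bvar k) ^ 2 * bvar k := by
      rw [rho2]; field_simp
    simp only [he]
    rw [hρ, show bias k * (1 - bias k) = bvar k from rfl]
    ring
  -- Step 3: split at degree `ℓ` and bound the tail by `ρ₂^{ℓ+1} Σ_S p̂(S)²`, then Parseval.
  refine h1.trans ?_
  rw [h2, ← sum_filter_add_sum_filter_not univ (fun S : Finset (Fin N) => S.card ≤ ℓ), mul_add]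
  refine add_le_add le_rfl ?_
  have htail : ∀ S ∈ univ.filter (fun S : Finset (Fin N) => ¬ S.card ≤ ℓ),
      rho2 k ^ S.card * (d S - cubeFourierCoeff p S) ^ 2 ≤ rho2 k ^ (ℓ + 1) * cubeFourierCoeff p S ^ 2 := by
    intro S hS
    rw [mem_filter] at hS
    have hlt : ℓ < S.card := not_le.mp hS.2
    rw [hd S hlt, zero_sub, neg_sq]
    exact mul_le_mul_of_nonneg_right (pow_le_pow_of_le_one hρ0 hρ1 hlt) (sq_nonneg _)
  calc 2 ^ (2 * N) * ∑ S ∈ univ.filter (fun S : Finset (Fin N) => ¬ S.card ≤ ℓ),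
        rho2 k ^ S.card * (d S - cubeFourierCoeff p S) ^ 2
      ≤ 2 ^ (2 * N) * ∑ S ∈ univ.filter (fun S : Finset (Fin N) => ¬ S.card ≤ ℓ),
        rho2 k ^ (ℓ + 1) * cubeFourierCoeff p S ^ 2 :=
        mul_le_mul_of_nonneg_left (sum_le_sum htail) (by positivity)
    _ ≤ 2 ^ (2 * N) * ∑ S, rho2 k ^ (ℓ + 1) * cubeFourierCoeff p S ^ 2 := by
        refine mul_le_mul_of_nonneg_left ?_ (by positivity)
        refine sum_le_sum_of_subset_of_nonneg (filter_subset _ _) fun S _ _ => ?_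
        positivity
    _ = rho2 k ^ (ℓ + 1) * 2 ^ N * ∑ x, p x ^ 2 := by
        rw [← mul_sum, sum_cubeFourierCoeff_sq, two_mul, pow_add]
        field_simp

/-- R3 as a record. [cite: BremnerMontanaroShepherd2017, §3.1 (displays 1–2) and Thm 4] -/
def ReadoutTruncationBound : Prop :=
  ∀ (N : ℕ) (k : Bool → Bool → ℝ), (∀ b, k false b + k true b = 1) → (∀ a b, 0 ≤ k a b) →
    0 < bias k → bias k < 1 →
    ∀ (p : (Fin N → Bool) → ℝ) (ℓ : ℕ) (d : Finset (Fin N) → ℝ), (∀ S, ℓ < S.card → d S = 0) →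
      (∑ y, |biasedFn k d y - kPush k p y|) ^ 2 ≤
        2 ^ (2 * N) * ∑ S ∈ univ.filter (fun S : Finset (Fin N) => S.card ≤ ℓ),
            rho2 k ^ S.card * (d S - cubeFourierCoeff p S) ^ 2 +
          rho2 k ^ (ℓ + 1) * 2 ^ N * ∑ x, p x ^ 2

/-- R3 holds. [cite: BremnerMontanaroShepherd2017, §3.1 (displays 1–2) and Thm 4] -/
theorem readoutTruncationBound_holds : ReadoutTruncationBound :=
  fun _ k hcol h0 hm0 hm1 p ℓ d hd => readout_truncation_l1_sq_le k hcol h0 hm0 hm1 p ℓ d hd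

/-- **Input anticoncentration form.** Under `Σ_x p(x)² ≤ α·2^{-N}` and exact low coefficients (`d_S = p̂(S)`,
`|S| ≤ ℓ`): `(Σ_y |F_d − k-read-out of p|)² ≤ ρ₂^{ℓ+1} α` — the BMS17 tail with `(1−ε)² ↦ ρ₂(k)`, NO `N`-dependence.
[cite: BremnerMontanaroShepherd2017, §3.1 (display 2 with Σ_x p(x)² ≤ α 2^{-n})] -/
theorem readout_truncation_of_anticoncentrated (k : Bool → Bool → ℝ) (hcol : ∀ b, k false b + k true b = 1)
    (h0 : ∀ a b, 0 ≤ k a b) (hm0 : 0 < bias k) (hm1 : bias k < 1)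
    (p : (Fin N → Bool) → ℝ) {α : ℝ} (hp : ∑ x, p x ^ 2 ≤ α * (2 ^ N)⁻¹) (ℓ : ℕ) :
    (∑ y, |biasedFn k (fun S => if S.card ≤ ℓ then cubeFourierCoeff p S else 0) y - kPush k p y|) ^ 2 ≤
      rho2 k ^ (ℓ + 1) * α := by
  have h := readout_truncation_l1_sq_le k hcol h0 hm0 hm1 p ℓ
    (fun S => if S.card ≤ ℓ then cubeFourierCoeff p S else 0) (fun S hS => if_neg (not_le.mpr hS))
  have hlow : ∑ S ∈ univ.filter (fun S : Finset (Fin N) => S.card ≤ ℓ),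
      rho2 k ^ S.card * ((if S.card ≤ ℓ then cubeFourierCoeff p S else 0) - cubeFourierCoeff p S) ^ 2 = 0 := by
    refine sum_eq_zero fun S hS => ?_
    rw [mem_filter] at hS
    simp [hS.2]
  rw [hlow, mul_zero, zero_add] at h
  refine h.trans ?_
  have hρ : 0 ≤ rho2 k ^ (ℓ + 1) := pow_nonneg (rho2_nonneg k hm0 hm1) _
  calc rho2 k ^ (ℓ + 1) * 2 ^ N * ∑ x, p x ^ 2 ≤ rho2 k ^ (ℓ + 1) * 2 ^ N * (α * (2 ^ N)⁻¹) :=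
        mul_le_mul_of_nonneg_left hp (by positivity)
    _ = rho2 k ^ (ℓ + 1) * α := by field_simp

/-! ### §5 R4 — the symmetric instance is the catalogued engine -/

/-- `bias (fKer η) = 1/2` for every `η`. [cite: FeffermanEtAl2023, Remark 10 (depolarizing read-out is unital)] -/
theorem bias_fKer (η : ℝ) : bias (fKer η) = 1 / 2 := by
  norm_num [bias, fKer]

/-- `gain (fKer η) = (1 − 2η)/2`. [cite: BremnerMontanaroShepherd2017, §3 (damping 1 − ε with ε = 2η)] -/
theorem gain_fKer (η : ℝ) : gain (fKer η) = (1 - 2 * η) / 2 := by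
  norm_num [gain, fKer]
  ring

/-- `bvar (fKer η) = 1/4`. [cite: FeffermanEtAl2023, Remark 10] -/
theorem bvar_fKer (η : ℝ) : bvar (fKer η) = 1 / 4 := by
  rw [bvar, bias_fKer]; norm_num

/-- `ρ₂(fKer η) = (1 − 2η)²` — the BMS17 damping. [cite: BremnerMontanaroShepherd2017, §3.1 (the factor (1−ε)²)] -/
theorem rho2_fKer (η : ℝ) : rho2 (fKer η) = (1 - 2 * η) ^ 2 := by
  rw [rho2, gain_fKer, bvar_fKer]; ring

/-- Degenerate symmetric kernels: the identity `fKer 0` and the NOT channel `fKer 1` have `ρ₂ = 1` (R3 then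
has a non-decaying tail — no content, as it must). [cite: BremnerMontanaroShepherd2017, Thm 4 (ε > 0 needed)] -/
theorem rho2_fKer_det : rho2 (fKer 0) = 1 ∧ rho2 (fKer 1) = 1 := by
  rw [rho2_fKer, rho2_fKer]; norm_num

/-- `bias (zKer q) = (1 − q)/2`. [cite: FeffermanEtAl2023, §5 (amplitude damping biases the read-out toward 0)] -/
theorem bias_zKer (q : ℝ) : bias (zKer q) = (1 - q) / 2 := by
  simp [bias, zKer]

/-- `gain (zKer q) = (1 − q)/2`. [cite: FeffermanEtAl2023, §5 (amplitude damping of strength q)] -/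
theorem gain_zKer (q : ℝ) : gain (zKer q) = (1 - q) / 2 := by
  simp [gain, zKer]

/-- `ρ₂(zKer q) = (1 − q)/(1 + q)` for `q ≠ ±1` (degree damping of the one-sided channel = that of a symmetric flip
of rate `η_eff = (1 − √((1−q)/(1+q)))/2`). [cite: FeffermanEtAl2023, Theorem 1 (the amplitude-damping rate r = q), here its degree damping] -/
theorem rho2_zKer {q : ℝ} (hq : q ≠ -1) (hq1 : q ≠ 1) : rho2 (zKer q) = (1 - q) / (1 + q) := by
  have h1 : (1 + q) ≠ 0 := fun h => hq (by linarith)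
  have h2 : (1 - q) ≠ 0 := fun h => hq1 (by linarith)
  have hden : (1 - q) / 2 * (1 - (1 - q) / 2) ≠ 0 := by
    have : (1 - q) / 2 * (1 - (1 - q) / 2) = (1 - q) * (1 + q) / 4 := by ring
    rw [this]
    exact div_ne_zero (mul_ne_zero h2 h1) four_ne_zero
  rw [rho2, bvar, bias_zKer, gain_zKer, div_eq_div_iff hden h1]
  ring

/-- The one-sided read-out meets the binders of R3 for `0 ≤ q < 1`: column-stochastic, nonnegative,
`bias = (1−q)/2 ∈ (0, 1/2]`. [cite: FeffermanEtAl2023, §5 (𝒩^(amp)_q is a channel for q ∈ [0,1])] -/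
theorem zKer_binders {q : ℝ} (h0 : 0 ≤ q) (h1 : q < 1) :
    (∀ b, zKer q false b + zKer q true b = 1) ∧ (∀ a b, 0 ≤ zKer q a b) ∧
      0 < bias (zKer q) ∧ bias (zKer q) < 1 := by
  refine ⟨fun b => ?_, fun a b => ?_, ?_, ?_⟩
  · cases b <;> simp [zKer]
  · cases a <;> cases b <;> simp [zKer, h0, h1.le]
  · rw [bias_zKer]; linarith
  · rw [bias_zKer]; linarith

/-- **R3 at the Z-channel** (a kernel outside the catalogued symmetric class): for `0 ≤ q < 1`,
`(Σ_y |F_d − (zKer q)-read-out of p|)² ≤ 2^{2N} Σ_{|S|≤ℓ} ((1−q)/(1+q))^{|S|}(d_S − p̂(S))² + ((1−q)/(1+q))^{ℓ+1}·2^N Σ_x p(x)²`.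
[cite: BremnerMontanaroShepherd2017, §3.1 (displays 1–2), with (1−ε)² ↦ (1−q)/(1+q); FeffermanEtAl2023, §5] -/
theorem zChannel_instance {q : ℝ} (hq0 : 0 ≤ q) (hq1 : q < 1) (p : (Fin N → Bool) → ℝ) (ℓ : ℕ)
    (d : Finset (Fin N) → ℝ) (hd : ∀ S, ℓ < S.card → d S = 0) :
    (∑ y, |biasedFn (zKer q) d y - kPush (zKer q) p y|) ^ 2 ≤
      2 ^ (2 * N) * ∑ S ∈ univ.filter (fun S : Finset (Fin N) => S.card ≤ ℓ),
          ((1 - q) / (1 + q)) ^ S.card * (d S - cubeFourierCoeff p S) ^ 2 +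
        ((1 - q) / (1 + q)) ^ (ℓ + 1) * 2 ^ N * ∑ x, p x ^ 2 := by
  obtain ⟨hcol, h0, hm0, hm1⟩ := zKer_binders hq0 hq1
  rw [← rho2_zKer (by linarith) hq1.ne]
  exact readout_truncation_l1_sq_le (zKer q) hcol h0 hm0 hm1 p ℓ d hd

/-- The uniform law is `bern (1/2)`. [cite: ODonnell2014, §8.4 (p = 1/2 is the uniform case)] -/
theorem bern_half (y : Fin N → Bool) : bern (1 / 2 : ℝ) y = (2 ^ N)⁻¹ := by
  rw [bern, prod_congr rfl (g := fun _ => (1 / 2 : ℝ)) fun i _ => by unfold bern1; split_ifs <;> norm_num,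
    prod_const, card_univ, Fintype.card_fin]
  simp

/-- At bias `1/2` the biased character is `2^{-|S|}·χ_S`. [cite: ODonnell2014, Def. 8.39–8.40 (at μ = 0 the biased basis is the usual one)] -/
theorem psiProd_half (S : Finset (Fin N)) (y : Fin N → Bool) :
    psiProd (1 / 2 : ℝ) S y = (1 / 2) ^ S.card * walsh S y := by
  rw [psiProd, walsh, ← prod_const, ← prod_mul_distrib]
  refine prod_congr rfl fun i _ => ?_
  unfold psi
  rcases Bool.eq_false_or_eq_true (y i) with h | h
  · norm_num [h]
  · norm_num [h]

/-- **Dictionary, synthesis side**: `biasedFn (fKer η) d = fourierFn (S ↦ (1−2η)^{|S|} d_S)`.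
[cite: BremnerMontanaroShepherd2017, §3.1 (q̃ = Σ_{|S|≤ℓ} c_S χ_S with c_S ≈ (1−ε)^{|S|} p̂(S))] -/
theorem biasedFn_fKer (η : ℝ) (d : Finset (Fin N) → ℝ) :
    biasedFn (fKer η) d = fourierFn (fun S => (1 - 2 * η) ^ S.card * d S) := by
  funext y
  rw [biasedFn, fourierFn, bias_fKer, bern_half, mul_sum]
  refine sum_congr rfl fun S _ => ?_
  have hc : gain (fKer η) / bvar (fKer η) = 2 * (1 - 2 * η) := by
    rw [gain_fKer, bvar_fKer]; ring
  rw [psiProd_half, hc, mul_pow, one_div, inv_pow]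
  have h2 : (2 : ℝ) ^ N ≠ 0 := by positivity
  have h2S : (2 : ℝ) ^ S.card ≠ 0 := by positivity
  field_simp

/-- **Dictionary, channel side**: on `Fin N`-indexed bits the flip read-out `kPush (fKer η)` IS the
catalogued noise operator `noiseOp η`. [cite: BremnerMontanaroShepherd2017, §3 (the noise operator 𝒩_ε); FeffermanEtAl2023, Remark 10] -/
theorem kPush_fKer_eq_noiseOp (η : ℝ) (p : (Fin N → Bool) → ℝ) : kPush (fKer η) p = noiseOp η p := by
  funext y
  rw [kPush_fKer]
  rfl

/-- **R4 · the symmetric instance.** At `k = fKer η` (`η ∈ [0,1]`) R3 reads, in the tree's variables,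
`‖fourierFn c − noiseOp η p‖₁² ≤ 2^{2N} Σ_{|S|≤ℓ} (c_S − (1−2η)^{|S|} p̂(S))² + ((1−2η)²)^{ℓ+1} 2^N Σ p²` at
`c_S = (1−2η)^{|S|} d_S` — literally the conclusion of `truncation_l1_sq_le`. [cite: BremnerMontanaroShepherd2017, §3.1 (displays 1–2)] -/
theorem symmetric_instance (p : (Fin N → Bool) → ℝ) {η : ℝ} (h0 : 0 ≤ η) (h1 : η ≤ 1) (ℓ : ℕ)
    (d : Finset (Fin N) → ℝ) (hd : ∀ S, ℓ < S.card → d S = 0) :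
    (∑ x, |fourierFn (fun S => (1 - 2 * η) ^ S.card * d S) x - noiseOp η p x|) ^ 2 ≤
      2 ^ (2 * N) * ∑ S ∈ univ.filter (fun S : Finset (Fin N) => S.card ≤ ℓ),
          ((1 - 2 * η) ^ S.card * d S - (1 - 2 * η) ^ S.card * cubeFourierCoeff p S) ^ 2 +
        ((1 - 2 * η) ^ 2) ^ (ℓ + 1) * 2 ^ N * ∑ x, p x ^ 2 := by
  have hcol : ∀ b, fKer η false b + fKer η true b = 1 := fun b => by cases b <;> simp [fKer]
  have hk0 : ∀ a b, 0 ≤ fKer η a b := fun a b => by unfold fKer; split_ifs <;> linarith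
  have hm0 : 0 < bias (fKer η) := by rw [bias_fKer]; norm_num
  have hm1 : bias (fKer η) < 1 := by rw [bias_fKer]; norm_num
  have h := readout_truncation_l1_sq_le (fKer η) hcol hk0 hm0 hm1 p ℓ d hd
  rw [biasedFn_fKer, kPush_fKer_eq_noiseOp, rho2_fKer] at h
  refine h.trans (le_of_eq ?_)
  congr 2
  refine sum_congr rfl fun S _ => ?_
  rw [← mul_sub, mul_pow, ← pow_mul, mul_comm 2 S.card, pow_mul]

/-- R4 as a record: the symmetric instance of R3 is the catalogued `truncation_l1_sq_le` shape.
[cite: BremnerMontanaroShepherd2017, §3.1 (displays 1–2)] -/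
def SymmetricInstance : Prop :=
  ∀ (N : ℕ) (p : (Fin N → Bool) → ℝ) (η : ℝ), 0 ≤ η → η ≤ 1 → ∀ (ℓ : ℕ) (d : Finset (Fin N) → ℝ),
    (∀ S, ℓ < S.card → d S = 0) →
      (∑ x, |fourierFn (fun S => (1 - 2 * η) ^ S.card * d S) x - noiseOp η p x|) ^ 2 ≤
        2 ^ (2 * N) * ∑ S ∈ univ.filter (fun S : Finset (Fin N) => S.card ≤ ℓ),
            ((1 - 2 * η) ^ S.card * d S - (1 - 2 * η) ^ S.card * cubeFourierCoeff p S) ^ 2 +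
          ((1 - 2 * η) ^ 2) ^ (ℓ + 1) * 2 ^ N * ∑ x, p x ^ 2

/-- R4 holds (via R3; the tree's `truncation_l1_sq_le` proves the same inequality directly).
[cite: BremnerMontanaroShepherd2017, §3.1 (displays 1–2)] -/
theorem symmetricInstance_holds : SymmetricInstance :=
  fun _ p _ h0 h1 ℓ d hd => symmetric_instance p h0 h1 ℓ d hd

/-- R4 is LITERALLY the catalogued inequality: the tree's `truncation_l1_sq_le` proves the same record
(coefficient table `c_S = (1−2η)^{|S|} d_S`; for `η ≠ 1/2` every degree-`≤ ℓ` table `c` has this form).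
[cite: BremnerMontanaroShepherd2017, §3.1 (displays 1–2)] -/
theorem symmetricInstance_of_tree : SymmetricInstance := fun _ p η h0 h1 ℓ d hd =>
  Literature.Barriers.QuantumAdvantage.truncation_l1_sq_le p h0 h1 ℓ (fun S => (1 - 2 * η) ^ S.card * d S)
    fun S hS => by simp [hd S hS]

/-! ### §6 R5 — why the Walsh-basis certificate fails off the symmetric point -/

/-- The read-out of the UNIFORM input is the biased product law `bern (bias k)` (column-stochastic `k`).
[cite: FeffermanEtAl2023, proof of Theorem 1 (noise applied to the maximally mixed input)] -/
theorem kPush_uniform_eq_bern (k : Bool → Bool → ℝ) (hcol : ∀ b, k false b + k true b = 1) (y : Fin N → Bool) :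
    kPush k (fun _ : Fin N → Bool => ((Fintype.card (Fin N → Bool) : ℝ))⁻¹) y = bern (bias k) y := by
  rw [NonunitalReadout.kPush_uniform, bern]
  refine prod_congr rfl fun i _ => ?_
  have h0 := hcol false
  have h1 := hcol true
  rcases Bool.eq_false_or_eq_true (y i) with h | h
  · -- `y i = true`: both sides are `(k(1|0) + k(1|1))/2`
    simp [h, bern1, bias]
  · -- `y i = false`: column sums
    simp [h, bern1, bias]
    linarith

/-- One biased bit against a sign: `Σ_b bern1 m b · (sgn b if i ∈ S else 1) = (1 − 2m if i ∈ S else 1)`.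
[cite: ODonnell2014, §8.4 (E[x_i] = μ for a biased bit), in {0,1} ↦ ±1 conventions] -/
theorem sum_bern1_mul_ite_sgn (m : ℝ) (P : Prop) [Decidable P] :
    ∑ b, bern1 m b * (if P then sgn b else 1) = if P then 1 - 2 * m else 1 := by
  rw [Fintype.sum_bool]
  by_cases hP : P
  · simp only [hP, if_true, bern1, Bool.false_eq_true, if_false, sgn_true, sgn_false]
    ring
  · simp only [hP, if_false, bern1, if_true, Bool.false_eq_true]
    ring

/-- **Walsh coefficients of the biased law**: `(bern m)^(S) = (1 − 2m)^{|S|} / 2^N`.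
[cite: ODonnell2014, §8.4 and Exercise 8.25 (usual Fourier expansion of a biased product law)] -/
theorem cubeFourierCoeff_bern (m : ℝ) (S : Finset (Fin N)) :
    cubeFourierCoeff (bern m) S = (1 - 2 * m) ^ S.card / 2 ^ N := by
  classical
  unfold cubeFourierCoeff
  congr 1
  have key : ∀ y : Fin N → Bool, bern m y * walsh S y = ∏ i, (bern1 m (y i) * (if i ∈ S then sgn (y i) else 1)) := by
    intro y
    rw [bern, Literature.Computability.Complexity.LowDegree.walsh_eq_prod_ite, ← prod_mul_distrib]
  simp_rw [key]
  rw [← Fintype.prod_sum (fun (i : Fin N) (b : Bool) => bern1 m b * (if i ∈ S then sgn b else 1))]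
  simp_rw [sum_bern1_mul_ite_sgn]
  rw [Fintype.prod_ite_mem, prod_const]

/-- **R5 · the Walsh-basis tail of the read-out of the trivial input (exact).**
`2^{2N} Σ_{|S|>ℓ} (bern m)^(S)² = Σ_{ℓ<j≤N} C(N,j) ((1−2m)²)^j` — the slack the uniform-basis certificate
`l1_sq_le_sum_cubeFourierCoeff_sq` must absorb for a degree-`ℓ` Walsh truncation of a biased read-out;
`= (1 + (1−2m)²)^N − Σ_{j≤ℓ} C(N,j)(1−2m)^{2j}`, unbounded in `N` at fixed `ℓ` for `m ≠ 1/2` (the biased error of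
R3 is `0` on this input). [cite: BremnerMontanaroShepherd2017, §3.1 (the tail Σ_{|S|>ℓ} of display 2), evaluated off the symmetric point; ODonnell2014, Exercise 8.25] -/
theorem walshTail_bern_eq (m : ℝ) (ℓ : ℕ) :
    2 ^ (2 * N) * ∑ S ∈ univ.filter (fun S : Finset (Fin N) => ℓ < S.card), cubeFourierCoeff (bern m) S ^ 2 =
      ∑ j ∈ (range (N + 1)).filter (fun j => ℓ < j), (N.choose j : ℝ) * ((1 - 2 * m) ^ 2) ^ j := by
  have h2 : (2 : ℝ) ^ N ≠ 0 := by positivity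
  have hS : ∀ S : Finset (Fin N), 2 ^ (2 * N) * cubeFourierCoeff (bern m) S ^ 2 = ((1 - 2 * m) ^ 2) ^ S.card := by
    intro S
    rw [cubeFourierCoeff_bern, div_pow, ← pow_mul, ← pow_mul, mul_comm N 2, ← mul_div_assoc,
      mul_div_cancel_left₀ _ (by positivity), mul_comm S.card 2, pow_mul]
  rw [mul_sum]
  simp_rw [hS]
  rw [sum_filter, sum_filter]
  have h := Finset.sum_powerset_apply_card (fun j => if ℓ < j then ((1 - 2 * m) ^ 2) ^ j else (0 : ℝ))
    (x := (univ : Finset (Fin N)))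
  rw [powerset_univ, card_univ, Fintype.card_fin] at h
  rw [h]
  refine sum_congr rfl fun j _ => ?_
  split_ifs <;> simp [nsmul_eq_mul]

/-- The tail dominates its first term: `C(N,ℓ+1)((1−2m)²)^{ℓ+1} ≤ 2^{2N} Σ_{|S|>ℓ} (bern m)^(S)²` (`ℓ + 1 ≤ N`). [cite: BremnerMontanaroShepherd2017, §3.1 (the tail of display 2), lower bound off the symmetric point] -/
theorem choose_mul_pow_le_walshTail (m : ℝ) {ℓ : ℕ} (hℓ : ℓ + 1 ≤ N) :
    (N.choose (ℓ + 1) : ℝ) * ((1 - 2 * m) ^ 2) ^ (ℓ + 1) ≤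
      2 ^ (2 * N) * ∑ S ∈ univ.filter (fun S : Finset (Fin N) => ℓ < S.card), cubeFourierCoeff (bern m) S ^ 2 := by
  rw [walshTail_bern_eq]
  refine single_le_sum (f := fun j => (N.choose j : ℝ) * ((1 - 2 * m) ^ 2) ^ j) (fun j _ => by positivity) ?_
  rw [mem_filter, mem_range]
  exact ⟨by omega, by omega⟩

/-- R5 as a record (exact Walsh tail of the biased read-out law + its first-term lower bound).
[cite: BremnerMontanaroShepherd2017, §3.1; ODonnell2014, Exercise 8.25] -/
def UniformBasisTail : Prop :=
  ∀ (N : ℕ) (m : ℝ) (ℓ : ℕ),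
    2 ^ (2 * N) * ∑ S ∈ univ.filter (fun S : Finset (Fin N) => ℓ < S.card), cubeFourierCoeff (bern m) S ^ 2 =
        ∑ j ∈ (range (N + 1)).filter (fun j => ℓ < j), (N.choose j : ℝ) * ((1 - 2 * m) ^ 2) ^ j ∧
      (ℓ + 1 ≤ N → (N.choose (ℓ + 1) : ℝ) * ((1 - 2 * m) ^ 2) ^ (ℓ + 1) ≤
        2 ^ (2 * N) * ∑ S ∈ univ.filter (fun S : Finset (Fin N) => ℓ < S.card), cubeFourierCoeff (bern m) S ^ 2)

/-- R5 holds. [cite: BremnerMontanaroShepherd2017, §3.1; ODonnell2014, Exercise 8.25] -/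
theorem uniformBasisTail_holds : UniformBasisTail :=
  fun _ m ℓ => ⟨walshTail_bern_eq m ℓ, fun hℓ => choose_mul_pow_le_walshTail m hℓ⟩

/-! ### §7 R6 — the one-sided channel keeps an exact flag -/

/-- **R6 · perfect flag.** Under amplitude-damped (Z-channel) read-out the all-ones outcome is reached
only from the all-ones string: `kPush (zKer q) p 1^N = (1 − q)^N · p(1^N)`, for every real `q` (a bare
identity; it is the flag identity post-selection arguments use, cf. `IQPPostselection` — nothing about
classes is typed here). [cite: FeffermanEtAl2023, §5 (amplitude damping never excites |0⟩ to |1⟩)] -/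
theorem kPush_zKer_allOnes (q : ℝ) (p : (Fin N → Bool) → ℝ) :
    kPush (zKer q) p (fun _ => true) = (1 - q) ^ N * p (fun _ => true) := by
  unfold kPush
  rw [sum_eq_single (fun _ : Fin N => true)]
  · simp [zKer, prod_const, card_univ, Fintype.card_fin]
  · intro x _ hx
    obtain ⟨i, hi⟩ : ∃ i, x i = false := by
      by_contra h
      push Not at h
      exact hx (funext fun i => by simpa using h i)
    rw [prod_eq_zero (mem_univ i) (by simp [zKer, hi]), zero_mul]
  · intro h; exact absurd (mem_univ _) h

/-- R6 as a record. [cite: FeffermanEtAl2023, §5] -/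
def PerfectFlag : Prop :=
  ∀ (N : ℕ) (q : ℝ) (p : (Fin N → Bool) → ℝ), kPush (zKer q) p (fun _ => true) = (1 - q) ^ N * p (fun _ => true)

/-- R6 holds. [cite: FeffermanEtAl2023, §5] -/
theorem perfectFlag_holds : PerfectFlag := fun _ q p => kPush_zKer_allOnes q p

/-- **Numbers** (illustration). (i) `ρ₂(zKer 1/10) = 9/11`, between the symmetric dampings of `η = 0.0477`,
`0.0478`; (ii) least `ℓ+1` with `ρ₂^{ℓ+1}·800 ≤ 1` (`α = 2`, `δ = 1/20`): `34` (`zKer 1/10`), `32` (`fKer 1/20`,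
`ρ₂ = 81/100`), `11` (`zKer 3/10`, `ρ₂ = 7/13`); (iii) Walsh-tail witness `C(20,3)·((1/2)²)³ = 1140/64 > 17`
(`N = 20`, `ℓ = 2`, `m = 1/4`; `δ² = 1/400`). [cite: BremnerMontanaroShepherd2017, Thm 4 (ℓ = O(log(α/δ)/ε)); FeffermanEtAl2023, Theorem 1] -/
theorem numbers :
    rho2 (zKer (1 / 10)) = 9 / 11 ∧
      ((1 - 2 * (478 / 10000 : ℝ)) ^ 2 < 9 / 11 ∧ (9 / 11 : ℝ) < (1 - 2 * (477 / 10000 : ℝ)) ^ 2) ∧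
      ((9 / 11 : ℝ) ^ 34 * 800 ≤ 1 ∧ 1 < (9 / 11 : ℝ) ^ 33 * 800) ∧
      (rho2 (fKer (1 / 20)) = 81 / 100 ∧ (81 / 100 : ℝ) ^ 32 * 800 ≤ 1 ∧ 1 < (81 / 100 : ℝ) ^ 31 * 800) ∧
      (rho2 (zKer (3 / 10)) = 7 / 13 ∧ (7 / 13 : ℝ) ^ 11 * 800 ≤ 1 ∧ 1 < (7 / 13 : ℝ) ^ 10 * 800) ∧
      ((Nat.choose 20 3 : ℝ) * (((1 - 2 * (1 / 4 : ℝ)) ^ 2) ^ 3) = 1140 / 64 ∧ (17 : ℝ) < 1140 / 64) := by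
  refine ⟨?_, ⟨by norm_num, by norm_num⟩, ⟨by norm_num, by norm_num⟩, ⟨?_, by norm_num, by norm_num⟩,
    ⟨?_, by norm_num, by norm_num⟩, ⟨?_, by norm_num⟩⟩
  · rw [rho2_zKer (by norm_num) (by norm_num)]; norm_num
  · rw [rho2_fKer]; norm_num
  · rw [rho2_zKer (by norm_num) (by norm_num)]; norm_num
  · have : Nat.choose 20 3 = 1140 := by decide
    rw [this]; norm_num

/-! ### §9 Addendum — ρ₂ under composition with a symmetric flip floor (both channel orders)

An independent symmetric flip `fKer η` composed with a memoryless read-out kernel `k` (L-08's `compKer k₂ k₁`: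
first `k₁`, then `k₂`): BEFORE the read-out it rescales the gain by `1 − 2η` and keeps the output bias, so `ρ₂`
is multiplied by exactly `(1−2η)²`; AFTER a column-stochastic read-out it also pulls the output bias toward `½`
(`m′ − ½ = (1−2η)(m − ½)`, `v′ − v = 4η(1−η)(m − ½)²`), so `ρ₂` is multiplied by AT MOST `(1−2η)²` — the two
channel orders of FeffermanEtAl2023 Thm 1 seen in the ρ₂ currency. Dictionary (no import): by
`XorNoiseFloorMonotonicity` an independent floor commutes to either end of an XOR-noise chain, so any independent
symmetric floor `η` in a memoryless read-out chain makes R3's damping `≤ (1−2η)²·ρ₂(k) ≤ (1−2η)²`. Law-level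
identities only; nothing about simulability. -/

open NonunitalReadout (compKer)

/-- Flip BEFORE read-out keeps the output bias: `m(k ∘ fKer η) = m(k)` (no hypothesis on `k`). [cite: FeffermanEtAl2023, Theorem 1 (the order 𝒩^(amp)∘𝒩^(dep)); ODonnell2014, Def. 8.39] -/
theorem bias_compKer_fKer (k : Bool → Bool → ℝ) (η : ℝ) : bias (compKer k (fKer η)) = bias k := by
  simp only [bias, compKer, fKer, Fintype.sum_bool]
  norm_num; ring

/-- Flip BEFORE read-out rescales the gain: `c(k ∘ fKer η) = (1 − 2η)·c(k)`. [cite: BremnerMontanaroShepherd2017, §3 (damping 1 − ε); FeffermanEtAl2023, Theorem 1] -/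
theorem gain_compKer_fKer (k : Bool → Bool → ℝ) (η : ℝ) : gain (compKer k (fKer η)) = (1 - 2 * η) * gain k := by
  simp only [gain, compKer, fKer, Fintype.sum_bool]
  norm_num; ring

/-- **ρ₂ composition, flip before read-out (exact):** `ρ₂(k ∘ fKer η) = (1 − 2η)²·ρ₂(k)` for every kernel `k`
and every real `η`. [cite: BremnerMontanaroShepherd2017, §3.1 (the factor (1−ε)²); FeffermanEtAl2023, Theorem 1 (channel order)] -/
theorem rho2_compKer_fKer (k : Bool → Bool → ℝ) (η : ℝ) :
    rho2 (compKer k (fKer η)) = (1 - 2 * η) ^ 2 * rho2 k := by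
  rw [rho2, rho2, bvar, bvar, bias_compKer_fKer, gain_compKer_fKer, mul_pow, mul_div_assoc]

/-- Flip AFTER a column-stochastic read-out moves the output bias toward `½`: `m(fKer η ∘ k) = η + (1 − 2η)·m(k)`.
[cite: FeffermanEtAl2023, Theorem 1 (the order 𝒩^(dep)∘𝒩^(amp)); ODonnell2014, Def. 8.39] -/
theorem bias_fKer_compKer (k : Bool → Bool → ℝ) (hcol : ∀ b, k false b + k true b = 1) (η : ℝ) :
    bias (compKer (fKer η) k) = η + (1 - 2 * η) * bias k := by
  have h0 := hcol false; have h1 := hcol true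
  simp only [bias, compKer, fKer, Fintype.sum_bool]
  norm_num
  linear_combination (η / 2) * h0 + (η / 2) * h1

/-- Flip AFTER a column-stochastic read-out rescales the gain: `c(fKer η ∘ k) = (1 − 2η)·c(k)`. [cite: BremnerMontanaroShepherd2017, §3; FeffermanEtAl2023, Theorem 1] -/
theorem gain_fKer_compKer (k : Bool → Bool → ℝ) (hcol : ∀ b, k false b + k true b = 1) (η : ℝ) :
    gain (compKer (fKer η) k) = (1 - 2 * η) * gain k := by
  have h0 := hcol false; have h1 := hcol true
  simp only [gain, compKer, fKer, Fintype.sum_bool]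
  norm_num
  linear_combination (η / 2) * h1 - (η / 2) * h0

/-- Flip AFTER read-out can only increase the output variance: `v(k) ≤ v(fKer η ∘ k)` for `0 ≤ η ≤ 1`
(`v′ − v = 4η(1−η)(m − ½)²`). [cite: FeffermanEtAl2023, Theorem 1 (the two orders differ); ODonnell2014, Def. 8.39] -/
theorem bvar_le_bvar_fKer_compKer (k : Bool → Bool → ℝ) (hcol : ∀ b, k false b + k true b = 1) {η : ℝ}
    (h0 : 0 ≤ η) (h1 : η ≤ 1) : bvar k ≤ bvar (compKer (fKer η) k) := by
  rw [bvar, bvar, bias_fKer_compKer k hcol]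
  nlinarith [mul_nonneg (mul_nonneg h0 (sub_nonneg.mpr h1)) (sq_nonneg (bias k - 1 / 2))]

/-- **ρ₂ composition, flip after read-out (inequality):** `ρ₂(fKer η ∘ k) ≤ (1 − 2η)²·ρ₂(k)` for a
column-stochastic `k` with `0 < v(k)` and `0 ≤ η ≤ 1` (with equality when `m(k) = ½` or `η ∈ {0, 1}`).
[cite: BremnerMontanaroShepherd2017, §3.1 (the factor (1−ε)²); FeffermanEtAl2023, Theorem 1 (channel order matters)] -/
theorem rho2_fKer_compKer_le (k : Bool → Bool → ℝ) (hcol : ∀ b, k false b + k true b = 1) {η : ℝ}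
    (h0 : 0 ≤ η) (h1 : η ≤ 1) (hv : 0 < bvar k) :
    rho2 (compKer (fKer η) k) ≤ (1 - 2 * η) ^ 2 * rho2 k := by
  rw [rho2, rho2, gain_fKer_compKer k hcol, mul_pow, mul_div_assoc]
  exact mul_le_mul_of_nonneg_left (div_le_div_of_nonneg_left (sq_nonneg _) hv
    (bvar_le_bvar_fKer_compKer k hcol h0 h1)) (sq_nonneg _)

/-- Numbers (illustration): a Z-channel `zKer (3/10)` (ρ₂ = 7/13) with a 5 % symmetric flip — before the
read-out `ρ₂ = (9/10)²·7/13 = 567/1300 ≈ 0.436`; after it `ρ₂ = (0.9·0.35)²/(0.365·0.635) ≈ 0.428 < 0.436`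
(checked as the exact rational inequality). [cite: FeffermanEtAl2023, Theorem 1 (order matters); BremnerMontanaroShepherd2017, §3.1] -/
theorem rho2_floor_numbers : ((9 : ℝ) / 10) ^ 2 * (7 / 13) = 567 / 1300 ∧
    ((9 : ℝ) / 10 * (7 / 20)) ^ 2 / ((73 / 200) * (127 / 200)) < 567 / 1300 := by
  constructor <;> norm_num

end BiasedReadout
end Literature.Computability.QuantumComplexity

end
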